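import Mathlib.NumberTheory.LSeries.AbstractFuncEq
import Mathlib.NumberTheory.LSeries.MellinEqDirichlet
import Mathlib.Analysis.SpecialFunctions.Gamma.Deligne
import Mathlib.Analysis.SpecialFunctions.Pow.Asymptotics
import Literature.NumberTheory.LFunctions.RiemannXiOrderProofs
import HarnessLib

/-!
# Mellin transforms of self-reciprocal weight-`1/2` theta series (Hecke's correspondence `(B) ⇒ (A)`)

Topic `Literature/NumberTheory/ModularForms`; namespace `Literature.NumberTheory.ModularForms`
(sub-namespace `WeightHalfTheta`). Everything is PROVED; no named facts, no definitions.

Data: complex coefficients `a : ℕ → ℂ`, real exponents `q : ℕ → ℝ` with `q n ≥ 1`, a polynomial-type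
summability `Σ ‖a n‖ q n ^ {-σ₀} < ∞`, and a function `φ : ℝ → ℂ` which on `(0, ∞)` is the general
theta series `φ(y) = Σ_n a_n e^{-π q_n y}` (hypothesis `hφ`, so that users may instantiate `φ` by
their own definition and `hφ := fun _ _ => rfl`). This is Hecke's side `(B)` of the correspondence
between exponential series with a weight-`k` transformation law under `y ↦ 1/y` and Dirichlet series
with the functional equation `s ↦ k - s` (Hecke 1936; Berndt–Knopp 2008, Thm 2.1), here for
`λ`-arbitrary exponents, weight `k = 1/2` and multiplier `+1`: `φ(1/y) = √y φ(y)` (hypothesis `hθ`).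

* `rpow_mul_exp_neg_mul_le` — the elementary `u^α e^{-bu} ≤ (α/b)^α`;
* `summable_norm_mul_exp`, `continuousOn_theta`, `exists_norm_theta_le`, `isBigO_theta` — absolute
  convergence for `y > 0`, continuity on `(0,∞)`, decay `‖φ(t)‖ ≤ K e^{-t}` (`t ≥ 1`), `φ = O(t^r)`;
* `mellin_theta_props` (from Mathlib's `WeakFEPair` / `IsStrongFEPair` with `f = g = φ`, `k = 1/2`,
  `ε = 1`, `f₀ = g₀ = 0`): `mellin φ` is ENTIRE, `mellin φ (1/2 - s) = mellin φ s`, and the Mellin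
  integral converges for every `s` — Berndt–Knopp Thm 2.1 `(B) ⇒ (A)` for weight `1/2`;
* `norm_mellin_theta_le` — the finite-order bound `‖mellin φ w‖ ≤ C + C exp(‖w‖ log(1+‖w‖))` on
  `Re w ≥ 1/4` (split `t^{x-1} ≤ t^{-3/4} + K t^{x-1}e^{-t}`-domination and `Γ(x) ≤ 4 + e^{x log(1+x)}`);
* `mellin_theta_half_eq_tsum` — the Dirichlet expansion `mellin φ (s/2) = Γ_ℝ(s) Σ a_n (√q_n)^{-s}`
  for `Re s > 0`, `Re s ≥ 2σ₀` (Mathlib `hasSum_mellin_pi_mul_sq`);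
* `hasSum_interleave` / `forall_ge_two_of_even_odd` — the bookkeeping used when the Dirichlet
  series of such a Mellin transform is merged with another one behind two fixed leading terms.

Deliberately NOT here: modular forms on Hecke groups, the converse direction `(A) ⇒ (B)`, poles
(`f₀, g₀ ≠ 0`), general weight.

## References

* E. Hecke, *Über die Bestimmung Dirichletscher Reihen durch ihre Funktionalgleichung*, Math. Ann.
  112 (1936), 664–699, §2. [Hecke1936]
* B. C. Berndt, M. I. Knopp, *Hecke's theory of modular forms and Dirichlet series*, World
  Scientific (2008), Ch. 2, Thm 2.1. [BerndtKnopp2008]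
-/

noncomputable section

open Complex Filter Set MeasureTheory Asymptotics
open scoped Real Topology

namespace Literature.NumberTheory.ModularForms

namespace WeightHalfTheta

/-! ## An elementary power-versus-exponential bound -/

/-- For `u > 0`, `b > 0`, `α ≥ 0`: `u ^ α · e^{-bu} ≤ (α / b) ^ α` (from `log v ≤ v - 1` at
`v = bu/α`). [folklore] -/
theorem rpow_mul_exp_neg_mul_le {u b α : ℝ} (hu : 0 < u) (hb : 0 < b) (hα : 0 ≤ α) :
    u ^ α * Real.exp (-(b * u)) ≤ (α / b) ^ α := by
  rcases hα.eq_or_lt with h0 | hα'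
  · rw [← h0, Real.rpow_zero, Real.rpow_zero, one_mul, Real.exp_le_one_iff]
    nlinarith
  · have hv : 0 < b * u / α := by positivity
    have hlog := Real.log_le_sub_one_of_pos hv
    have hab : 0 < α / b := div_pos hα' hb
    rw [Real.rpow_def_of_pos hu, Real.rpow_def_of_pos hab, ← Real.exp_add, Real.exp_le_exp]
    have h1 : Real.log u = Real.log (b * u / α) + Real.log (α / b) := by
      rw [← Real.log_mul hv.ne' hab.ne']
      congr 1
      field_simp
    have h2 : Real.log (b * u / α) * α ≤ b * u - α := by
      have := mul_le_mul_of_nonneg_right hlog hα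
      calc Real.log (b * u / α) * α ≤ (b * u / α - 1) * α := this
        _ = b * u - α := by field_simp
    have key : Real.log u * α ≤ Real.log (α / b) * α + (b * u - α) := by
      rw [h1, add_mul]
      linarith
    linarith

/-- For `q ≥ 1`, `t > 0` and any real `σ₀`: `e^{-π q t} ≤ (α/(πt))^α · q^{-σ₀}` with
`α = max σ₀ 0`. [folklore] -/
theorem exp_neg_pi_mul_le_rpow {q t : ℝ} (σ₀ : ℝ) (hq : 1 ≤ q) (ht : 0 < t) :
    Real.exp (-π * q * t) ≤ (max σ₀ 0 / (π * t)) ^ (max σ₀ 0) * q ^ (-σ₀) := by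
  set α := max σ₀ 0 with hα
  have hα0 : 0 ≤ α := le_max_right _ _
  have hq0 : 0 < q := by linarith
  have h1 : q ^ α * Real.exp (-(π * t * q)) ≤ (α / (π * t)) ^ α :=
    rpow_mul_exp_neg_mul_le hq0 (by positivity) hα0
  have h2 : q ^ (-α) ≤ q ^ (-σ₀) :=
    Real.rpow_le_rpow_of_exponent_le hq (neg_le_neg (le_max_left _ _))
  have h3 : 0 ≤ q ^ (-α) := Real.rpow_nonneg hq0.le _
  have hqα : q ^ α * q ^ (-α) = 1 := by
    rw [Real.rpow_neg hq0.le, mul_inv_cancel₀ (Real.rpow_pos_of_pos hq0 _).ne']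
  calc Real.exp (-π * q * t) = Real.exp (-(π * t * q)) * (q ^ α * q ^ (-α)) := by
        rw [hqα, mul_one]
        congr 1
        ring
    _ = (q ^ α * Real.exp (-(π * t * q))) * q ^ (-α) := by ring
    _ ≤ (α / (π * t)) ^ α * q ^ (-α) := by gcongr
    _ ≤ (α / (π * t)) ^ α * q ^ (-σ₀) := by gcongr

/-! ## Absolute convergence, continuity and decay of the theta series -/

/-- The norm of a term `a · e^{x}` of a theta series. [folklore] -/
theorem norm_mul_ofReal_exp (c : ℂ) (x : ℝ) : ‖c * (Real.exp x : ℂ)‖ = ‖c‖ * Real.exp x := by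
  rw [norm_mul, Complex.norm_real, Real.norm_eq_abs, abs_of_pos (Real.exp_pos x)]

/-- `Σ ‖a_n‖ e^{-π q_n t} < ∞` for every `t > 0`, from `Σ ‖a_n‖ q_n^{-σ₀} < ∞` and `q_n ≥ 1`.
[folklore] -/
theorem summable_norm_mul_exp {a : ℕ → ℂ} {q : ℕ → ℝ} {σ₀ : ℝ} (hq : ∀ n, 1 ≤ q n)
    (hs : Summable fun n => ‖a n‖ * q n ^ (-σ₀)) {t : ℝ} (ht : 0 < t) :
    Summable fun n => ‖a n‖ * Real.exp (-π * q n * t) := by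
  refine (hs.mul_left ((max σ₀ 0 / (π * t)) ^ (max σ₀ 0))).of_nonneg_of_le
    (fun n => by positivity) fun n => ?_
  calc ‖a n‖ * Real.exp (-π * q n * t)
      ≤ ‖a n‖ * ((max σ₀ 0 / (π * t)) ^ max σ₀ 0 * q n ^ (-σ₀)) := by
        gcongr
        exact exp_neg_pi_mul_le_rpow σ₀ (hq n) ht
    _ = _ := by ring

/-- The terms `a_n e^{-π q_n t}` are absolutely summable in `ℂ` for `t > 0`. [folklore] -/
theorem summable_term {a : ℕ → ℂ} {q : ℕ → ℝ} {σ₀ : ℝ} (hq : ∀ n, 1 ≤ q n)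
    (hs : Summable fun n => ‖a n‖ * q n ^ (-σ₀)) {t : ℝ} (ht : 0 < t) :
    Summable fun n => a n * (Real.exp (-π * q n * t) : ℂ) := by
  refine Summable.of_norm ?_
  simpa only [norm_mul_ofReal_exp] using summable_norm_mul_exp hq hs ht

/-- The theta series `y ↦ Σ a_n e^{-π q_n y}` is continuous on `(0, ∞)` (locally uniform
convergence). [cite: BerndtKnopp2008, Ch. 2 (proof of Thm 2.1)] -/
theorem continuousOn_theta {a : ℕ → ℂ} {q : ℕ → ℝ} {σ₀ : ℝ} (hq : ∀ n, 1 ≤ q n)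
    (hs : Summable fun n => ‖a n‖ * q n ^ (-σ₀)) {φ : ℝ → ℂ}
    (hφ : ∀ y, 0 < y → φ y = ∑' n, a n * (Real.exp (-π * q n * y) : ℂ)) :
    ContinuousOn φ (Ioi 0) := by
  have hT : ContinuousOn (fun y : ℝ => ∑' n, a n * (Real.exp (-π * q n * y) : ℂ)) (Ioi 0) := by
    intro y hy
    have hδ : 0 < y / 2 := half_pos hy
    have hcont : ContinuousOn (fun y : ℝ => ∑' n, a n * (Real.exp (-π * q n * y) : ℂ))
        (Ioi (y / 2)) := by
      refine continuousOn_tsum (fun n => ?_) (summable_norm_mul_exp hq hs hδ) fun n x hx => ?_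
      · fun_prop
      · rw [norm_mul_ofReal_exp]
        have hx' : y / 2 ≤ x := le_of_lt hx
        have hqn : 0 ≤ π * q n := mul_nonneg Real.pi_pos.le (by linarith [hq n])
        exact mul_le_mul_of_nonneg_left (Real.exp_le_exp.2 (by nlinarith)) (norm_nonneg _)
    exact (hcont.continuousAt (Ioi_mem_nhds (by linarith))).continuousWithinAt
  exact hT.congr fun y hy => hφ y hy

/-- Exponential decay: `‖φ(t)‖ ≤ K e^{-t}` for `t ≥ 1`, with `K = e · Σ ‖a_n‖ e^{-π q_n} ≥ 0`.
[cite: BerndtKnopp2008, Ch. 2 (proof of Thm 2.1)] -/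
theorem exists_norm_theta_le {a : ℕ → ℂ} {q : ℕ → ℝ} {σ₀ : ℝ} (hq : ∀ n, 1 ≤ q n)
    (hs : Summable fun n => ‖a n‖ * q n ^ (-σ₀)) {φ : ℝ → ℂ}
    (hφ : ∀ y, 0 < y → φ y = ∑' n, a n * (Real.exp (-π * q n * y) : ℂ)) :
    ∃ K : ℝ, 0 ≤ K ∧ ∀ t : ℝ, 1 ≤ t → ‖φ t‖ ≤ K * Real.exp (-t) := by
  have hS := summable_norm_mul_exp hq hs one_pos
  refine ⟨Real.exp 1 * ∑' n, ‖a n‖ * Real.exp (-π * q n * 1), by positivity, fun t ht => ?_⟩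
  have ht0 : 0 < t := by linarith
  have hSt := summable_norm_mul_exp hq hs ht0
  have hnorm : Summable fun n => ‖a n * (Real.exp (-π * q n * t) : ℂ)‖ := by
    simpa only [norm_mul_ofReal_exp] using hSt
  rw [hφ t ht0]
  calc ‖∑' n, a n * (Real.exp (-π * q n * t) : ℂ)‖
      ≤ ∑' n, ‖a n * (Real.exp (-π * q n * t) : ℂ)‖ := norm_tsum_le_tsum_norm hnorm
    _ = ∑' n, ‖a n‖ * Real.exp (-π * q n * t) := by simp_rw [norm_mul_ofReal_exp]
    _ ≤ ∑' n, (Real.exp 1 * Real.exp (-t)) * (‖a n‖ * Real.exp (-π * q n * 1)) := by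
        refine hSt.tsum_le_tsum (fun n => ?_) (hS.mul_left _)
        have hπq : 1 ≤ π * q n := by nlinarith [Real.two_le_pi, hq n]
        have hexp : Real.exp (-π * q n * t) ≤
            Real.exp 1 * Real.exp (-t) * Real.exp (-π * q n * 1) := by
          rw [← Real.exp_add, ← Real.exp_add]
          exact Real.exp_le_exp.2 (by nlinarith [mul_nonneg (sub_nonneg.2 hπq) (sub_nonneg.2 ht)])
        calc ‖a n‖ * Real.exp (-π * q n * t)
            ≤ ‖a n‖ * (Real.exp 1 * Real.exp (-t) * Real.exp (-π * q n * 1)) := by gcongr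
          _ = _ := by ring
    _ = Real.exp 1 * (∑' n, ‖a n‖ * Real.exp (-π * q n * 1)) * Real.exp (-t) := by
        rw [tsum_mul_left]
        ring

/-- `φ(t) = O(t^r)` at `+∞` for every real `r`. [folklore] -/
theorem isBigO_theta {a : ℕ → ℂ} {q : ℕ → ℝ} {σ₀ : ℝ} (hq : ∀ n, 1 ≤ q n)
    (hs : Summable fun n => ‖a n‖ * q n ^ (-σ₀)) {φ : ℝ → ℂ}
    (hφ : ∀ y, 0 < y → φ y = ∑' n, a n * (Real.exp (-π * q n * y) : ℂ)) (r : ℝ) :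
    φ =O[atTop] fun t : ℝ => t ^ r := by
  obtain ⟨K, -, hK⟩ := exists_norm_theta_le hq hs hφ
  have h1 : φ =O[atTop] fun t : ℝ => Real.exp (-1 * t) := by
    refine IsBigO.of_bound K ?_
    filter_upwards [eventually_ge_atTop 1] with t ht
    rw [neg_one_mul, Real.norm_of_nonneg (Real.exp_pos _).le]
    exact hK t ht
  exact h1.trans (isLittleO_exp_neg_mul_rpow_atTop one_pos r).isBigO

/-! ## The strong FE-pair and its consequences -/

/-- **Hecke's correspondence `(B) ⇒ (A)`, weight `1/2`, multiplier `1`** (Berndt–Knopp Thm 2.1): if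
`φ(1/y) = √y φ(y)` then the Mellin transform `Λ = mellin φ` is ENTIRE, satisfies
`Λ(1/2 - s) = Λ(s)`, and its defining integral converges absolutely for every `s` (Mathlib's
`IsStrongFEPair` with `f = g = φ`, `k = 1/2`, `ε = 1`). [cite: BerndtKnopp2008, Thm 2.1] -/
theorem mellin_theta_props {a : ℕ → ℂ} {q : ℕ → ℝ} {σ₀ : ℝ} (hq : ∀ n, 1 ≤ q n)
    (hs : Summable fun n => ‖a n‖ * q n ^ (-σ₀)) {φ : ℝ → ℂ}
    (hφ : ∀ y, 0 < y → φ y = ∑' n, a n * (Real.exp (-π * q n * y) : ℂ))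
    (hθ : ∀ y, 0 < y → φ (1 / y) = (Real.sqrt y : ℂ) * φ y) :
    Differentiable ℂ (mellin φ) ∧ (∀ s : ℂ, mellin φ (1 / 2 - s) = mellin φ s) ∧
      ∀ s : ℂ, MellinConvergent φ s := by
  have hcont := continuousOn_theta hq hs hφ
  let P : WeakFEPair ℂ :=
    { f := φ, g := φ, k := 1 / 2, ε := 1, f₀ := 0, g₀ := 0,
      hf_int := hcont.locallyIntegrableOn measurableSet_Ioi,
      hg_int := hcont.locallyIntegrableOn measurableSet_Ioi,
      hk := by norm_num, hε := one_ne_zero,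
      h_feq := fun x hx => by
        rw [hθ x hx, one_mul, smul_eq_mul, Real.sqrt_eq_rpow],
      hf_top := fun r => by simpa using isBigO_theta hq hs hφ r,
      hg_top := fun r => by simpa using isBigO_theta hq hs hφ r }
  have hP : IsStrongFEPair P := ⟨rfl, rfl⟩
  have hΛ : P.Λ = mellin φ := hP.Λ_eq
  refine ⟨hΛ ▸ hP.differentiable_Λ, fun s => ?_, fun s => (hP.hasMellin s).1⟩
  have h1 := P.functional_equation s
  rw [hΛ, hP.symm_Λ_eq] at h1
  simpa [P] using h1

/-! ## The finite-order bound -/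

/-- **Growth of the Mellin transform**: for `Re w ≥ 1/4`,
`‖mellin φ w‖ ≤ C + C exp(‖w‖ log(1 + ‖w‖))`. Proof: dominate `t^{x-1}‖φ(t)‖` by
`t^{-3/4}‖φ(t)‖ + K t^{x-1} e^{-t}` (the first integrable by Mellin convergence at `1/4`, the
second with integral `K Γ(x)`), and `Γ(x) ≤ 4 + e^{x log(1+x)}`. [folklore] -/
theorem norm_mellin_theta_le {a : ℕ → ℂ} {q : ℕ → ℝ} {σ₀ : ℝ} (hq : ∀ n, 1 ≤ q n)
    (hs : Summable fun n => ‖a n‖ * q n ^ (-σ₀)) {φ : ℝ → ℂ}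
    (hφ : ∀ y, 0 < y → φ y = ∑' n, a n * (Real.exp (-π * q n * y) : ℂ))
    (hθ : ∀ y, 0 < y → φ (1 / y) = (Real.sqrt y : ℂ) * φ y) :
    ∃ C : ℝ, 0 ≤ C ∧ ∀ w : ℂ, 1 / 4 ≤ w.re →
      ‖mellin φ w‖ ≤ C + C * Real.exp (‖w‖ * Real.log (1 + ‖w‖)) := by
  obtain ⟨K, hK0, hK⟩ := exists_norm_theta_le hq hs hφ
  have hconv : MellinConvergent φ ((1 / 4 : ℝ) : ℂ) := (mellin_theta_props hq hs hφ hθ).2.2 _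
  have hint1 : IntegrableOn (fun t : ℝ => ‖(t : ℂ) ^ (((1 / 4 : ℝ) : ℂ) - 1) • φ t‖) (Ioi 0) :=
    hconv.norm
  set C₀ : ℝ := ∫ t in Ioi (0 : ℝ), ‖(t : ℂ) ^ (((1 / 4 : ℝ) : ℂ) - 1) • φ t‖ with hC₀
  have hC₀0 : 0 ≤ C₀ := integral_nonneg fun t => norm_nonneg _
  refine ⟨C₀ + 4 * K + K, by positivity, fun w hw => ?_⟩
  set x : ℝ := w.re with hxdef
  have hx0 : 0 < x := by linarith
  have hint2 : IntegrableOn (fun t : ℝ => K * (Real.exp (-t) * t ^ (x - 1))) (Ioi 0) :=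
    (Real.GammaIntegral_convergent hx0).const_mul K
  have key : ‖mellin φ w‖ ≤ ∫ t in Ioi (0 : ℝ),
      (‖(t : ℂ) ^ (((1 / 4 : ℝ) : ℂ) - 1) • φ t‖ + K * (Real.exp (-t) * t ^ (x - 1))) := by
    refine norm_integral_le_of_norm_le (hint1.add hint2) ?_
    rw [ae_restrict_iff' measurableSet_Ioi]
    refine Eventually.of_forall fun t (ht : 0 < t) => ?_
    rw [norm_smul, norm_smul, Complex.norm_cpow_eq_rpow_re_of_pos ht,
      Complex.norm_cpow_eq_rpow_re_of_pos ht]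
    simp only [sub_re, one_re, ofReal_re]
    rcases le_or_gt t 1 with ht1 | ht1
    · calc t ^ (x - 1) * ‖φ t‖ ≤ t ^ (1 / 4 - 1 : ℝ) * ‖φ t‖ :=
            mul_le_mul_of_nonneg_right (Real.rpow_le_rpow_of_exponent_ge ht ht1 (by linarith))
              (norm_nonneg _)
        _ ≤ t ^ (1 / 4 - 1 : ℝ) * ‖φ t‖ + K * (Real.exp (-t) * t ^ (x - 1)) :=
            le_add_of_nonneg_right (by positivity)
    · calc t ^ (x - 1) * ‖φ t‖ ≤ t ^ (x - 1) * (K * Real.exp (-t)) := by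
            gcongr
            exact hK t ht1.le
        _ = K * (Real.exp (-t) * t ^ (x - 1)) := by ring
        _ ≤ t ^ (1 / 4 - 1 : ℝ) * ‖φ t‖ + K * (Real.exp (-t) * t ^ (x - 1)) :=
            le_add_of_nonneg_left (by positivity)
  rw [integral_add hint1 hint2, integral_const_mul, ← Real.Gamma_eq_integral hx0] at key
  have hG := Literature.NumberTheory.LFunctions.Real.Gamma_le_of_quarter_le hw
  have hxw : x ≤ ‖w‖ := Complex.re_le_norm w
  have hmono : Real.exp (x * Real.log (1 + x)) ≤ Real.exp (‖w‖ * Real.log (1 + ‖w‖)) := by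
    refine Real.exp_le_exp.2 (mul_le_mul hxw (Real.log_le_log (by linarith) (by linarith))
      (Real.log_nonneg (by linarith)) (norm_nonneg _))
  have hexp0 : 0 ≤ Real.exp (‖w‖ * Real.log (1 + ‖w‖)) := (Real.exp_pos _).le
  calc ‖mellin φ w‖ ≤ C₀ + K * Real.Gamma x := key
    _ ≤ C₀ + K * (4 + Real.exp (‖w‖ * Real.log (1 + ‖w‖))) := by
        gcongr
        exact hG.trans (by linarith)
    _ = (C₀ + 4 * K) + K * Real.exp (‖w‖ * Real.log (1 + ‖w‖)) := by ring
    _ ≤ (C₀ + 4 * K + K) + (C₀ + 4 * K + K) * Real.exp (‖w‖ * Real.log (1 + ‖w‖)) := by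
        have h2 : K * Real.exp (‖w‖ * Real.log (1 + ‖w‖)) ≤
            (C₀ + 4 * K + K) * Real.exp (‖w‖ * Real.log (1 + ‖w‖)) :=
          mul_le_mul_of_nonneg_right (by linarith) hexp0
        linarith

/-! ## The Dirichlet expansion -/

/-- **Dirichlet expansion of the Mellin transform**: for `Re s > 0` and `Re s ≥ 2σ₀`,
`mellin φ (s/2) = Γ_ℝ(s) · Σ_n a_n (√q_n)^{-s}` (termwise `∫₀^∞ e^{-π q t} t^{s/2-1} dt
= (π q)^{-s/2} Γ(s/2)`, absolute convergence). [cite: BerndtKnopp2008, Thm 2.1] -/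
theorem mellin_theta_half_eq_tsum {a : ℕ → ℂ} {q : ℕ → ℝ} {σ₀ : ℝ} (hq : ∀ n, 1 ≤ q n)
    (hs : Summable fun n => ‖a n‖ * q n ^ (-σ₀)) {φ : ℝ → ℂ}
    (hφ : ∀ y, 0 < y → φ y = ∑' n, a n * (Real.exp (-π * q n * y) : ℂ))
    {s : ℂ} (hs0 : 0 < s.re) (hsσ : 2 * σ₀ ≤ s.re) :
    mellin φ (s / 2) = s.Gammaℝ * ∑' n, a n * ((Real.sqrt (q n) : ℂ) ^ (-s)) := by
  have hq0 : ∀ n, 0 ≤ q n := fun n => zero_le_one.trans (hq n)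
  have hr : ∀ n, Real.sqrt (q n) ≠ 0 := fun n => (Real.sqrt_pos.2 (by linarith [hq n])).ne'
  have hsq : ∀ n, Real.sqrt (q n) ^ 2 = q n := fun n => Real.sq_sqrt (hq0 n)
  have habs : ∀ n, |Real.sqrt (q n)| = Real.sqrt (q n) := fun n => abs_of_nonneg (Real.sqrt_nonneg _)
  have hmain := hasSum_mellin_pi_mul_sq (a := a) (r := fun n => Real.sqrt (q n)) (F := φ) (s := s)
    hs0 ?_ ?_
  · rw [← hmain.tsum_eq, ← tsum_mul_left]
    refine tsum_congr fun n => ?_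
    rw [habs, cpow_neg, div_eq_mul_inv, mul_assoc]
  · intro t ht
    simp only [hr, if_false, hsq]
    rw [hφ t ht]
    exact (summable_term hq hs ht).hasSum
  · refine hs.of_nonneg_of_le (fun n => by positivity) fun n => ?_
    have hqpos : 0 < q n := by linarith [hq n]
    rw [habs, Real.sqrt_eq_rpow, ← Real.rpow_mul (hq0 n), div_eq_mul_inv,
      ← Real.rpow_neg (hq0 n)]
    exact mul_le_mul_of_nonneg_left (Real.rpow_le_rpow_of_exponent_le (hq n) (by linarith))
      (norm_nonneg _)

/-! ## Interleaving two Dirichlet series -/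

/-- **Interleaving two series behind two fixed leading terms**: if `h` agrees with `F` at `0, 1`
and at the even places `2k+2 ↦ F(k+2)`, and with `G` at the odd places `2k+3 ↦ G(k)`, then
`h` is summable with `Σ h = Σ F + Σ G`. [folklore] -/
theorem hasSum_interleave {α : Type*} [NormedAddCommGroup α] {F G h : ℕ → α} {x y : α}
    (hF : HasSum F x) (hG : HasSum G y) (h0 : h 0 = F 0) (h1 : h 1 = F 1)
    (he : ∀ k, h (2 * k + 2) = F (k + 2)) (ho : ∀ k, h (2 * k + 3) = G k) :
    HasSum h (x + y) := by
  have hF2 : HasSum (fun k => F (k + 2)) (x - (F 0 + F 1)) := by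
    have := (hasSum_nat_add_iff' (f := F) 2).2 hF
    rwa [Finset.sum_range_succ, Finset.sum_range_one] at this
  have hE : HasSum (fun k => (fun n => h (n + 2)) (2 * k)) (x - (F 0 + F 1)) := by
    have heq : (fun k => (fun n => h (n + 2)) (2 * k)) = fun k => F (k + 2) :=
      funext fun k => he k
    rw [heq]
    exact hF2
  have hO : HasSum (fun k => (fun n => h (n + 2)) (2 * k + 1)) y := by
    have heq : (fun k => (fun n => h (n + 2)) (2 * k + 1)) = G := funext fun k => ho k
    rw [heq]
    exact hG
  have h3 : HasSum (fun n => h (n + 2)) (x - (F 0 + F 1) + y) :=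
    HasSum.even_add_odd (f := fun n => h (n + 2)) hE hO
  have h4 := HasSum.sum_range_add (f := h) (k := 2) h3
  rw [Finset.sum_range_succ, Finset.sum_range_one, h0, h1] at h4
  convert h4 using 1
  abel

/-- Every `n ≥ 2` is `2k+2` or `2k+3` (the case analysis paired with `hasSum_interleave`).
[folklore] -/
theorem forall_ge_two_of_even_odd {P : ℕ → Prop} (he : ∀ k, P (2 * k + 2))
    (ho : ∀ k, P (2 * k + 3)) : ∀ n, 2 ≤ n → P n := by
  intro n hn
  obtain ⟨k, hk | hk⟩ := Nat.even_or_odd' n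
  · obtain ⟨j, rfl⟩ : ∃ j, k = j + 1 := ⟨k - 1, by omega⟩
    rw [hk, show 2 * (j + 1) = 2 * j + 2 by ring]
    exact he j
  · obtain ⟨j, rfl⟩ : ∃ j, k = j + 1 := ⟨k - 1, by omega⟩
    rw [hk, show 2 * (j + 1) + 1 = 2 * j + 3 by ring]
    exact ho j

end WeightHalfTheta

end Literature.NumberTheory.ModularForms

end
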